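import Summits.ValiantsHypothesis.ValiantsHypothesis.Theorems.SymPencilPerFourPeeledTen
import Summits.ValiantsHypothesis.ValiantsHypothesis.Theorems.SymPencilPerFourInnerRankOfPeeled

/-!
# Route `SymPencil` — inner rank of the `2 | 2` row split of `per_4`: the peeled hypothesis
# `HR2` at ten squares DISCHARGED; cell (8,8,10) of the size-27 table is empty
# (`--supports` stmt-ValiantsHypothesis-5674 `SdcSuperquadratic`; (8,8) column; rung currency only)

`…InnerRankOfPeeled.IR_of_peeled` / `…false_of_rank_eight_le_twentySeven_of_peeled_ten` pin the
one remaining input of cell (8,8,10) as the hypothesis `HR2` («no peeled reduced family on `≤ 10`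
squares», stated on the `exists_reduced_family` data).  `…PeeledTen.false_of_peeled_le_ten` proves
exactly that (without even using the reduced identity), so:

* `HR2_ten` — the binder `HR2` of those theorems at `d = 10`, verbatim, as a theorem;
* `IR10` — the `2 | 2` inner-rank identity of `per_4` is impossible on `10` squares;
* `false_of_rank_eight_le_twentySeven` — cell (8,8,10) of `m = 27`:
  `…OfPeeled.false_of_rank_eight_le_twentySeven_of_peeled_ten` with `HR2` removed.

Honest framing: this empties ONE cell of the size-27 table of the route's bookkeeping (the desk's
books decide what that does to `27 ≤ sdc(per_4)`); the (8,8,11) cell (peeled case at eleven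
squares) is OPEN; the crux stmt-5674 and `VP ≠ VNP` are untouched.  No definitions, no named
facts. [folklore]
-/

noncomputable section

-- single-conjunct layout: Sub = Summit, duplicated namespace component intended
set_option linter.dupNamespace false

namespace Summit.ValiantsHypothesis.ValiantsHypothesis.Theorems.SymPencilPerFourPeeledTenHR2

open Matrix Finset Module MvPolynomial
open Literature.Computability.AlgebraicComplexity
open Summit.ValiantsHypothesis.ValiantsHypothesis.Theorems.SymPencilPerFourPeeledTen
open Summit.ValiantsHypothesis.ValiantsHypothesis.Theorems.SymPencilPerFourInnerRankOfPeeled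

/-- **`HR2` at `d = 10`.**  The hypothesis of `IR_of_peeled` / `…of_peeled_ten`, verbatim (the
reduced identity is not needed). [folklore] -/
theorem HR2_ten (K : Type*) [Field K] [CharZero K] :
    ∀ (κ : Type) [Fintype κ] [DecidableEq κ], Fintype.card κ ≤ 10 →
      ∀ (c : κ → K), (∀ r, c r ≠ 0) →
      ∀ (t : κ → (((Fin 4 → K) × (Fin 4 → K)) →ₗ[K] ((Fin 4 → K) × (Fin 4 → K)) →ₗ[K] K)),
      (∀ a b y₂ y₃ : Fin 4 → K,
        ∑ r, c r * (t r (a, b) (y₂, y₃)) ^ 2 = (Matrix.of ![a, b, y₂, y₃]).permanent) →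
      ∀ (v₀ v₀' : κ → K),
      (∀ (a x : Fin 4 → K), ∃ s : K, (fun r => t r (a, 0) (x, 0)) = s • v₀) →
      (∀ (b x : Fin 4 → K), ∃ s : K, (fun r => t r (0, b) (0, x)) = s • v₀') →
      (∀ a b y₂ y₃ : Fin 4 → K,
        ∑ r, c r * (t r (0, b) (y₂, 0) + t r (a, 0) (0, y₃)) ^ 2 =
          (Matrix.of ![a, b, y₂, y₃]).permanent
            - 2 * ∑ r, c r * t r (a, 0) (y₂, 0) * t r (0, b) (0, y₃)) →
      (∃ a b y z : Fin 4 → K, ∑ r, c r * t r (a, 0) (y, 0) * t r (0, b) (0, z) ≠ 0) → False :=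
  fun _ _ _ hκ c hc t hJ v₀ v₀' hv₀ hv₀' _ hpeel =>
    false_of_peeled_le_ten hκ c hc t hJ v₀ v₀' hv₀ hv₀' hpeel

/-- **IR10.**  The `2 | 2` inner-rank identity `Σ_{r<10} c_r t_r((a,b),(y₂,y₃))² = per(a;b;y₂;y₃)`
has no solution on ten squares (P1 + the peeled case, composed by `IR_of_peeled`). [folklore] -/
theorem IR10 (K : Type*) [Field K] [CharZero K] :
    ∀ (c : Fin 10 → K)
      (t : Fin 10 → (((Fin 4 → K) × (Fin 4 → K)) →ₗ[K] ((Fin 4 → K) × (Fin 4 → K)) →ₗ[K] K)),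
      ¬ ∀ a b y₂ y₃ : Fin 4 → K,
        ∑ r, c r * (t r (a, b) (y₂, y₃)) ^ 2 = (Matrix.of ![a, b, y₂, y₃]).permanent :=
  IR_of_peeled (by norm_num) (HR2_ten K)

/-- **Cell `(8, 8, 10)` of `m = 27` is empty** — `…InnerRankOfPeeled.
false_of_rank_eight_le_twentySeven_of_peeled_ten` with its hypothesis `HR2` discharged by
`HR2_ten`. [folklore] -/
theorem false_of_rank_eight_le_twentySeven (K : Type*) [Field K] [CharZero K]
    {m : ℕ} (hm : m ≤ 27)
    {i₀ : Fin m} {D : Matrix {i // i ≠ i₀} {i // i ≠ i₀} K}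
    {bL : (Fin 4 × Fin 4 → K) →ₗ[K] ({i // i ≠ i₀} → K)}
    {CL : (Fin 4 × Fin 4 → K) →ₗ[K] Matrix {i // i ≠ i₀} {i // i ≠ i₀} K} {κ₀ : K}
    (hD : IsUnit D.det) (hDs : Dᵀ = D) (hCs : ∀ z, (CL z)ᵀ = CL z) (hκ₀ : κ₀ ≠ 0)
    (hi : ∀ z, bL z ⬝ᵥ D⁻¹ *ᵥ bL z = 0)
    (hii : ∀ z, bL z ⬝ᵥ (D⁻¹ * CL z * D⁻¹) *ᵥ bL z = 0)
    (hiii : ∀ z, D.det * (bL z ⬝ᵥ (D⁻¹ * CL z * D⁻¹ * CL z * D⁻¹) *ᵥ bL z) =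
      -(κ₀ * eval z (perPoly (Fin 4) K)))
    (hV4 : ∀ x ∈ LinearMap.ker bL, ∀ r c : Fin 4,
      ((Matrix.of fun i j => x (i, j)).submatrix r.succAbove c.succAbove).permanent = 0)
    (hcard : Fintype.card {i // i ≠ i₀} + 1 = m)
    (hrn : finrank K (LinearMap.range bL) + finrank K (LinearMap.ker bL) = 16)
    (h8 : finrank K (LinearMap.range bL) = 8) : False :=
  false_of_rank_eight_le_twentySeven_of_peeled_ten K hm hD hDs hCs hκ₀ hi hii hiii hV4 hcard hrn
    (HR2_ten K) h8

end Summit.ValiantsHypothesis.ValiantsHypothesis.Theorems.SymPencilPerFourPeeledTenHR2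

end
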